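import Literature.Computability.Learning.AmpPFunction
import Literature.Computability.Learning.NaturalLearningRun
import HarnessLib

/-!
# One run of the CIKK `AC⁰[p]` learner (odd `p`) succeeds with noticeable probability

Groundwork for the named fact `Literature.Computability.Learning.cikk_learn_AC0Mod` (CIKK 2016,
Cor. 5.4), odd primes: the analogue of `NaturalLearningRun.card_goodRun_ge` for the amplifier
`AMP_p(f) = E^{vN} ∘ ((f^k)^{GL_p})^{2T}` of `AmpPFunction.lean` (CIKK Thm. 4.8). One run chains
FIVE stages, each succeeding with noticeable probability over its own coins:

1. NW reconstruction (`card_goodAdvice_ge`): a predictor `h₁` for `AMP_p(f)`;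
2. von Neumann stage (`card_goodVNCoins_ge` on the ideal inputs, `ideal_agreement_ge`): a
   predictor for the `𝔽_p`-GL symbol `Σ rᵢ f(xᵢ)` with success `1/p + γ`;
3. `𝔽_p`-Goldreich–Levin (`card_goodSeedGuess_ge_p`): a direct-product oracle for `f'^k`,
   `f' = f ∘ fst` on `UJ = {0,1}ⁿ × Fin B` (the junk quotient of a position travels with its point);
4. IJKW decoding (`directProduct_decoding_bits`): a hypothesis `h'` for `f'` with error `≤ δ₁`;
5. the junk coin `q₀` (Markov, `card_heavyRows_le`): `x ↦ h'(x, q₀)` has error `≤ 2δ₁`.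

* `ampPIdxEquiv`, `ampPFin` — `AMP_p(f)` on `2T(kn + kβ)` enumerated bits;
* `SGCoinsP`, `DCCoinsP`, `RunCoinsP`, `nwStageP`, `idealPred`, `vnStageP`, `glStageP`,
  `runHypP` — the coins and the hypothesis of one run;
* **`card_goodRunP_ge`** — the run succeeds (error `≤ 2δ₁ · 2ⁿ`) for at least a
  `η₁ · (μ/2) · ρ · (3ρ/16)(1 - 2e^{-k/8}) · (1/2)` fraction of the coins.

## References

* M. Carmosino, R. Impagliazzo, V. Kabanets, A. Kolokolova, *Learning algorithms from natural
  proofs*, CCC 2016, Thm. 2.11, Thm. 4.1, Thm. 4.2, Thm. 4.7, Thm. 4.8, Thm. 5.1 (proof), §5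
  (complete algorithm) [CarmosinoImpagliazzoKabanetsKolokolova2016].
-/

namespace Literature.Computability.Learning

open Finset Matrix Literature.Computability.MetaComplexity Literature.Computability.Cryptography
  Literature.Computability.Complexity Literature.Computability.Complexity.DirectProduct

variable {p : ℕ} [hp : Fact p.Prime] {n k β T : ℕ}

/-! ### The coins and the stages of one run -/

section Run

variable {L m kk t : ℕ}

/-- The coins of the `𝔽_p`-GL stage: seed tuple and guess. [folklore] -/
abbrev SGCoinsP (p k kk : ℕ) : Type := (Fin kk → FVec p k) × (Fin kk → ZMod p)

/-- The coins of the DP stage over `UJ`. [folklore] -/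
abbrev DCCoinsP (n p β k t : ℕ) : Type :=
  (Fin k → Bool) × (Fin k → UJ n p β) × (Fin t → Fin k × (Fin k → UJ n p β))

/-- The coins of one run (left-nested): NW advice, vN coins, GL coins, DP coins, junk coin. [folklore] -/
abbrev RunCoinsP (n p β k T L m kk t : ℕ) : Type :=
  (((AdvCoins L m × VNCoins (SBlk n k p β) T p) × SGCoinsP p k kk) × DCCoinsP n p β k t) × Fin (jB p β)

-- the nested coin products exceed the default instance size bound
set_option synthInstance.maxSize 1024
set_option synthInstance.maxHeartbeats 200000

variable (e : Fin L → (Fin (T * 2 * (k * n + k * β)) ↪ Fin m)) (D : (Fin L → Bool) → Bool)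
  (f : (Fin n → Bool) → Bool)

variable (p) in
/-- Stage 1: the NW predictor for `AMP_p(f)`. [cite: CarmosinoImpagliazzoKabanetsKolokolova2016, §5 (complete algorithm, step 3)] -/
noncomputable def nwStageP (adv : AdvCoins L m) : (Fin (T * 2 * (k * n + k * β)) → Bool) → Bool :=
  nwPredictor e (ampPFin p f k β T) D adv.1 adv.2.1 adv.2.2

/-- A predictor read in the ideal model. [folklore] -/
def idealPred (h₁ : (Fin (T * 2 * (k * n + k * β)) → Bool) → Bool) (w : Fin (T * 2) → SBlk n k p β) : Bool :=
  h₁ (encode w ∘ (ampPIdxEquiv n k β T).symm)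

/-- Stage 2: the von Neumann predictor for the `𝔽_p`-GL symbol of `f'^k`. [cite: CarmosinoImpagliazzoKabanetsKolokolova2016, Thm. 4.7] -/
noncomputable def vnStageP (h₁ : (Fin (T * 2 * (k * n + k * β)) → Bool) → Bool)
    (c : VNCoins (SBlk n k p β) T p) : SBlk n k p β → ZMod p :=
  vnPred (dpGLP (fJ (p := p) (β := β) f)) (idealPred h₁) c

/-- Reading a `0/1` field element as a bit. [folklore] -/
def zmodToBoolP (c : ZMod p) : Bool := decide (c = 1)

/-- Stage 3: the `𝔽_p`-GL candidate for `f'^k(x⃗)` as a direct-product oracle. [cite: CarmosinoImpagliazzoKabanetsKolokolova2016, Thm. 4.2 / Claim 4.4] -/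
noncomputable def glStageP (C₂ : SBlk n k p β → ZMod p) (θ : ℝ) (sg : SGCoinsP p k kk) :
    (Fin k → UJ n p β) → Fin k → Bool :=
  fun xs i => zmodToBoolP (glCandG kk (fun r => C₂ (xs, r)) sg.2 θ sg.1 i)

/-- **The hypothesis of one run**: the IJKW decoder for `f'` on top of the GL stage on top of the
vN stage on top of the NW stage, evaluated at `(x, q₀)`. [cite: CarmosinoImpagliazzoKabanetsKolokolova2016, §5 (complete algorithm) with Thm. 4.8] -/
noncomputable def runHypP (θ : ℝ) (ω : RunCoinsP n p β k T L m kk t) : (Fin n → Bool) → Bool := fun x =>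
  decode (glStageP (vnStageP f (nwStageP p e D f ω.1.1.1.1) ω.1.1.1.2) θ ω.1.1.2) (posSet ω.1.2.1) ω.1.2.2.1
    (fJ f ∘ ω.1.2.2.1) false ω.1.2.2.2 (x, ω.2)

/-! ### Bridges -/

/-- The GL stage is exactly right on `x⃗` as soon as the candidate is `f'^k(x⃗)`. [folklore] -/
theorem errSet_glStageP_eq_empty (C₂ : SBlk n k p β → ZMod p) (θ : ℝ) (sg : SGCoinsP p k kk)
    (xs : Fin k → UJ n p β) (h : glCandG kk (fun r => C₂ (xs, r)) sg.2 θ sg.1 = dpVecP (fJ f) xs) :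
    errSet (glStageP C₂ θ sg) (fJ f) xs = ∅ := by
  rw [errSet_eq_empty_iff]
  intro i
  simp only [glStageP, h, dpVecP, zmodToBoolP]
  cases fJ f (xs i)
  · simp
  · simp

omit hp in
/-- Markov over the junk coin: if `h'` errs on at most `δ|UJ|` points of `UJ = {0,1}ⁿ × Fin B`,
then for at least half of the `q₀` the slice `x ↦ h'(x, q₀)` errs on at most `2δ · 2ⁿ` points.
[folklore] -/
theorem card_goodJunk_ge (h' : UJ n p β → Bool) {δ : ℝ} (hδ : 0 < δ)
    (herr : ((univ.filter fun u : UJ n p β => h' u ≠ fJ f u).card : ℝ) ≤ δ * Fintype.card (UJ n p β)) :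
    (1 / 2 : ℝ) * Fintype.card (Fin (jB p β)) ≤
      ((univ.filter fun q₀ : Fin (jB p β) =>
        ((univ.filter fun x : Fin n → Bool => h' (x, q₀) ≠ f x).card : ℝ) ≤
          2 * δ * Fintype.card (Fin n → Bool)).card : ℝ) := by
  classical
  have hpairs : ((univ.filter fun q : Fin (jB p β) × (Fin n → Bool) => h' (q.2, q.1) ≠ f q.2).card : ℝ) ≤
      δ * (Fintype.card (Fin (jB p β)) * Fintype.card (Fin n → Bool)) := by
    have hre : (univ.filter fun q : Fin (jB p β) × (Fin n → Bool) => h' (q.2, q.1) ≠ f q.2).card =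
        (univ.filter fun u : UJ n p β => h' u ≠ fJ f u).card := by
      rw [← card_filter_univ_equiv (Equiv.prodComm (Fin (jB p β)) (Fin n → Bool))]
      rfl
    rw [hre]
    refine herr.trans (le_of_eq ?_)
    rw [Fintype.card_prod]; push_cast; ring
  have hheavy := card_heavyRows_le (A := Fin (jB p β)) (B := Fin n → Bool)
    (fun q₀ x => h' (x, q₀) ≠ f x) (η := δ) (θ := 2 * δ) (by positivity) hpairs
  have hηθ : δ / (2 * δ) = 1 / 2 := by field_simp
  rw [hηθ] at hheavy
  have hsplit := Finset.card_filter_add_card_filter_not (s := (univ : Finset (Fin (jB p β))))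
    (fun q₀ => 2 * δ * Fintype.card (Fin n → Bool) < ((univ.filter fun x : Fin n → Bool => h' (x, q₀) ≠ f x).card : ℝ))
  rw [card_univ] at hsplit
  have hnot : (univ.filter fun q₀ : Fin (jB p β) => ¬ (2 * δ * Fintype.card (Fin n → Bool) <
      ((univ.filter fun x : Fin n → Bool => h' (x, q₀) ≠ f x).card : ℝ))) =
      (univ.filter fun q₀ : Fin (jB p β) => ((univ.filter fun x : Fin n → Bool => h' (x, q₀) ≠ f x).card : ℝ) ≤
        2 * δ * Fintype.card (Fin n → Bool)) := filter_congr fun q₀ _ => not_lt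
  rw [hnot] at hsplit
  have hcast : ((univ.filter fun q₀ : Fin (jB p β) => 2 * δ * Fintype.card (Fin n → Bool) <
      ((univ.filter fun x : Fin n → Bool => h' (x, q₀) ≠ f x).card : ℝ)).card : ℝ) +
      ((univ.filter fun q₀ : Fin (jB p β) => ((univ.filter fun x : Fin n → Bool => h' (x, q₀) ≠ f x).card : ℝ) ≤
        2 * δ * Fintype.card (Fin n → Bool)).card : ℝ) = Fintype.card (Fin (jB p β)) := by
    exact_mod_cast hsplit
  linarith

/-! ### One run succeeds with noticeable probability -/

/-- **One run of the `AC⁰[p]` learner succeeds with probability `≥ p₀`** (exact counting form of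
Thm. 2.11 ∘ Thm. 4.7 ∘ Thm. 4.2/Claim 4.4 ∘ Thm. 4.1 inside the proof of CIKK Thm. 5.1, for the
amplifier of Thm. 4.8). With `η₁ = 1/(10L)`, `ν = 2Tkp/2^β ≤ 1/2`,
`μ = (η₁ - 2ν - p^{-T}/2)/(2Tp) ≥ 0`, `γ = μ/2`, `θ = γ/(8p)`, `ρ = γ/(8p^{kk})`, the GL condition
`(k+1)p ≤ 2θ²·#reps` and the direct-product conditions with `ε := ρ`, `δ := δ₁`: for at least a
`η₁ (μ/2) ρ (3ρ/16)(1 - 2e^{-k/8}) / 2` fraction of the coins, `runHypP` errs on at most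
`2δ₁ · 2ⁿ` inputs. [cite: CarmosinoImpagliazzoKabanetsKolokolova2016, Thm. 5.1 (proof) with Thm. 4.8] -/
theorem card_goodRunP_ge (hL : 0 < L) (hk : 0 < k) (hT : 0 < T) (hβ : p ≤ 2 ^ β)
    (hadv : (1 / 5 : ℝ) ≤ advantage D (nwGenerator e (ampPFin p f k β T)))
    (hν : (T * 2 : ℕ) * k * p / (2 : ℝ) ^ β ≤ 1 / 2)
    (hμ : 0 ≤ (1 / (10 * L) - 2 * ((T * 2 : ℕ) * k * p / (2 : ℝ) ^ β) - 1 / (2 * (p : ℝ) ^ T)) / (p * (T * 2 : ℕ)))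
    (hm0 : 0 < (reps p kk).card)
    (hGL : ((k + 1) * p : ℝ) ≤ 2 * ((1 / (10 * L) - 2 * ((T * 2 : ℕ) * k * p / (2 : ℝ) ^ β) - 1 / (2 * (p : ℝ) ^ T)) /
      (p * (T * 2 : ℕ)) / 2 / 2 / (4 * p)) ^ 2 * (reps p kk).card)
    {δ₁ : ℝ} (hδ₁ : 0 < δ₁)
    (H1u : Real.exp (-(3 * δ₁ * k / 2048)) ≤
      ((1 / (10 * L) - 2 * ((T * 2 : ℕ) * k * p / (2 : ℝ) ^ β) - 1 / (2 * (p : ℝ) ^ T)) / (p * (T * 2 : ℕ)) / 2 /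
        (8 * p ^ kk)) ^ 2 * δ₁ / 4096)
    (H2u : Real.exp (-(k * δ₁ ^ 2 / 2048)) ≤
      (1 / (10 * L) - 2 * ((T * 2 : ℕ) * k * p / (2 : ℝ) ^ β) - 1 / (2 * (p : ℝ) ^ T)) / (p * (T * 2 : ℕ)) / 2 /
        (8 * p ^ kk) / 4)
    (H3u : Real.exp (-(t * ((1 / (10 * L) - 2 * ((T * 2 : ℕ) * k * p / (2 : ℝ) ^ β) - 1 / (2 * (p : ℝ) ^ T)) /
      (p * (T * 2 : ℕ)) / 2 / (8 * p ^ kk)) / 32)) ≤ δ₁ / 16) :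
    let μ : ℝ := (1 / (10 * L) - 2 * ((T * 2 : ℕ) * k * p / (2 : ℝ) ^ β) - 1 / (2 * (p : ℝ) ^ T)) / (p * (T * 2 : ℕ))
    let ρ : ℝ := μ / 2 / (8 * p ^ kk)
    1 / (10 * L) * (μ / 2) * ρ * (3 * ρ / 16 * (1 - 2 * Real.exp (-(k / 8 : ℝ)))) * (1 / 2) *
        Fintype.card (RunCoinsP n p β k T L m kk t) ≤
      ((univ.filter fun ω : RunCoinsP n p β k T L m kk t =>
        ((univ.filter fun x => runHypP e D f (μ / 2 / 2 / (4 * p)) ω x ≠ f x).card : ℝ) ≤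
          2 * δ₁ * Fintype.card (Fin n → Bool)).card : ℝ) := by
  intro μ ρ
  classical
  set η₁ : ℝ := 1 / (10 * L) with hη₁
  set ν : ℝ := (T * 2 : ℕ) * k * p / (2 : ℝ) ^ β with hνdef
  have hL' : (0 : ℝ) < L := Nat.cast_pos.2 hL
  have hpR : (0 : ℝ) < p := by exact_mod_cast hp.out.pos
  have hη₁0 : 0 < η₁ := by positivity
  have hμ0 : 0 ≤ μ := hμ
  have hρ0 : 0 ≤ ρ := by positivity
  have hB : 0 < jB p β := jB_pos hβ
  haveI : Nonempty (Fin (jB p β)) := ⟨⟨0, hB⟩⟩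
  -- if `μ = 0` the GL condition would force `(k+1)p ≤ 0`
  have hγpos : 0 < μ / 2 := by
    rcases hμ0.lt_or_eq with hlt | heq
    · positivity
    · exfalso
      have hGL' : ((k + 1) * p : ℝ) ≤ 2 * (μ / 2 / 2 / (4 * p)) ^ 2 * (reps p kk).card := hGL
      rw [← heq] at hGL'
      norm_num at hGL'
      exact absurd hGL' (not_le.2 (by positivity))
  -- Stage 1: good NW advice
  set GA₁ := univ.filter fun adv : AdvCoins L m =>
    1 / 2 + η₁ ≤ agreement (nwStageP p e D f adv) (ampPFin p f k β T) with hGA₁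
  have h1 : η₁ * Fintype.card (AdvCoins L m) ≤ (GA₁.card : ℝ) := by
    have h := card_goodAdvice_ge e (ampPFin p f k β T) D hL (adv := 1 / 5) (by norm_num) hadv
    have hηeq : (1 / 5 : ℝ) / (2 * L) = η₁ := by rw [hη₁]; field_simp; ring
    rw [hηeq] at h
    exact h
  -- Stage 2: for good advice, good vN coins
  have h2 : ∀ adv ∈ GA₁, μ / 2 * Fintype.card (VNCoins (SBlk n k p β) T p) ≤
      ((univ.filter fun c : VNCoins (SBlk n k p β) T p =>
        (1 / p + μ / 2) * Fintype.card (SBlk n k p β) ≤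
          ((univ.filter fun σ : SBlk n k p β => vnStageP f (nwStageP p e D f adv) c σ = dpGLP (fJ f) σ).card : ℝ)).card : ℝ) := by
    intro adv hadv1
    have hagree := (mem_filter.1 hadv1).2
    set h₁ := nwStageP p e D f adv with hh₁
    -- agreement on enumerated bits → on `AmpPIdx`-indexed inputs
    have hA0 : (1 / 2 + η₁) * Fintype.card (AmpPIdx n k β T → Bool) ≤
        ((univ.filter fun u : AmpPIdx n k β T → Bool =>
          h₁ (u ∘ (ampPIdxEquiv n k β T).symm) = ampP p f k β T u).card : ℝ) := by
      rw [← card_agree_ampPFin]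
      have hN : (0 : ℝ) < Fintype.card (Fin (T * 2 * (k * n + k * β)) → Bool) := Nat.cast_pos.2 Fintype.card_pos
      rw [agreement, le_div_iff₀ hN] at hagree
      rw [Fintype.card_congr (Equiv.arrowCongr (ampPIdxEquiv n k β T) (Equiv.refl Bool))]
      exact hagree
    -- to the ideal model
    have hideal := ideal_agreement_ge hβ (fun u => h₁ (u ∘ (ampPIdxEquiv n k β T).symm)) f hη₁0.le hν hA0
    -- the vN stage
    have hvn := card_goodVNCoins_ge (dpGLP (fJ (p := p) (β := β) f)) (idealPred h₁) hT (η := η₁ - 2 * ν) hμ hideal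
    exact hvn
  have h12 := card_filter_prod_ge_mul GA₁ _ (by positivity) h1 h2
  -- Stage 3: for good (advice, vN coins), good (seed, guess)
  set GA₁₂ := (univ : Finset (AdvCoins L m × VNCoins (SBlk n k p β) T p)).filter fun av =>
    av.1 ∈ GA₁ ∧ (1 / p + μ / 2) * Fintype.card (SBlk n k p β) ≤
      ((univ.filter fun σ : SBlk n k p β => vnStageP f (nwStageP p e D f av.1) av.2 σ = dpGLP (fJ f) σ).card : ℝ)
    with hGA₁₂
  have h3 : ∀ av ∈ GA₁₂, ρ * Fintype.card (SGCoinsP p k kk) ≤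
      ((univ.filter fun sg : SGCoinsP p k kk =>
        ρ * Fintype.card (Fin k → UJ n p β) ≤
          ((univ.filter fun xs : Fin k → UJ n p β =>
            glCandG kk (fun r => vnStageP f (nwStageP p e D f av.1) av.2 (xs, r)) sg.2 (μ / 2 / 2 / (4 * p)) sg.1 =
              dpVecP (fJ f) xs).card : ℝ)).card : ℝ) := by
    intro av hav
    obtain ⟨-, hacc⟩ := (mem_filter.1 hav).2
    have hcount : (1 / p + μ / 2) * (Fintype.card (Fin k → UJ n p β) * Fintype.card (FVec p k)) ≤
        ((univ.filter fun q : (Fin k → UJ n p β) × FVec p k =>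
          vnStageP f (nwStageP p e D f av.1) av.2 q = dpGLP (fJ f) q).card : ℝ) := by
      rw [← Nat.cast_mul, ← Fintype.card_prod]
      exact hacc
    exact card_goodSeedGuess_ge_p kk (fJ (p := p) (β := β) f) (vnStageP f (nwStageP p e D f av.1) av.2)
      (γ := μ / 2) hγpos hm0 hGL hcount
  have h123 := card_filter_prod_ge_mul GA₁₂ _ hρ0 (by rw [Fintype.card_prod]; push_cast; exact h12) h3
  -- Stage 4: for good (advice, vN, seed, guess), good decoder coins
  set GA₁₂₃ := (univ : Finset ((AdvCoins L m × VNCoins (SBlk n k p β) T p) × SGCoinsP p k kk)).filter fun avs =>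
    avs.1 ∈ GA₁₂ ∧ ρ * Fintype.card (Fin k → UJ n p β) ≤
      ((univ.filter fun xs : Fin k → UJ n p β =>
        glCandG kk (fun r => vnStageP f (nwStageP p e D f avs.1.1) avs.1.2 (xs, r)) avs.2.2 (μ / 2 / 2 / (4 * p)) avs.2.1 =
          dpVecP (fJ f) xs).card : ℝ) with hGA₁₂₃
  have h4 : ∀ avs ∈ GA₁₂₃,
      3 * ρ / 16 * (1 - 2 * Real.exp (-(k / 8 : ℝ))) * Fintype.card (DCCoinsP n p β k t) ≤
        ((univ.filter fun dc : DCCoinsP n p β k t =>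
          ((univ.filter fun u : UJ n p β =>
            decode (glStageP (vnStageP f (nwStageP p e D f avs.1.1) avs.1.2) (μ / 2 / 2 / (4 * p)) avs.2)
              (posSet dc.1) dc.2.1 (fJ f ∘ dc.2.1) false dc.2.2 u ≠ fJ f u).card : ℝ) ≤
            δ₁ * Fintype.card (UJ n p β)).card : ℝ) := by
    intro avs havs
    obtain ⟨-, hg⟩ := (mem_filter.1 havs).2
    rcases hρ0.lt_or_eq with hρpos | hρ0'
    · have hC : ρ * Fintype.card (Fin k → UJ n p β) ≤
          ((univ.filter fun xs : Fin k → UJ n p β =>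
            errSet (glStageP (vnStageP f (nwStageP p e D f avs.1.1) avs.1.2) (μ / 2 / 2 / (4 * p)) avs.2) (fJ f) xs = ∅).card : ℝ) := by
        refine hg.trans ?_
        exact_mod_cast card_le_card fun xs hxs => mem_filter.2 ⟨mem_univ _,
          errSet_glStageP_eq_empty f _ _ avs.2 xs (mem_filter.1 hxs).2⟩
      exact directProduct_decoding_bits (glStageP (vnStageP f (nwStageP p e D f avs.1.1) avs.1.2) (μ / 2 / 2 / (4 * p)) avs.2)
        (fJ f) hk hρpos hδ₁ hC H1u H2u H3u false
    · rw [← hρ0']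
      simp only [mul_zero, zero_div, zero_mul]
      exact Nat.cast_nonneg _
  -- Stage 5: the junk coin
  set GA₁₂₃₄ := (univ : Finset (((AdvCoins L m × VNCoins (SBlk n k p β) T p) × SGCoinsP p k kk) × DCCoinsP n p β k t)).filter
    fun w => w.1 ∈ GA₁₂₃ ∧ ((univ.filter fun u : UJ n p β =>
      decode (glStageP (vnStageP f (nwStageP p e D f w.1.1.1) w.1.1.2) (μ / 2 / 2 / (4 * p)) w.1.2)
        (posSet w.2.1) w.2.2.1 (fJ f ∘ w.2.2.1) false w.2.2.2 u ≠ fJ f u).card : ℝ) ≤ δ₁ * Fintype.card (UJ n p β)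
    with hGA₁₂₃₄
  have h5 : ∀ w ∈ GA₁₂₃₄, (1 / 2 : ℝ) * Fintype.card (Fin (jB p β)) ≤
      ((univ.filter fun q₀ : Fin (jB p β) =>
        ((univ.filter fun x : Fin n → Bool =>
          decode (glStageP (vnStageP f (nwStageP p e D f w.1.1.1) w.1.1.2) (μ / 2 / 2 / (4 * p)) w.1.2)
            (posSet w.2.1) w.2.2.1 (fJ f ∘ w.2.2.1) false w.2.2.2 (x, q₀) ≠ f x).card : ℝ) ≤
          2 * δ₁ * Fintype.card (Fin n → Bool)).card : ℝ) := by
    intro w hw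
    obtain ⟨-, herr⟩ := (mem_filter.1 hw).2
    exact card_goodJunk_ge f _ hδ₁ herr
  -- assemble
  by_cases hq : 0 ≤ 1 - 2 * Real.exp (-(k / 8 : ℝ))
  · have h1234 := card_filter_prod_ge_mul GA₁₂₃ _ (q := 3 * ρ / 16 * (1 - 2 * Real.exp (-(k / 8 : ℝ))))
      (by positivity) (by rw [Fintype.card_prod]; push_cast; exact h123) h4
    have h12345 := card_filter_prod_ge_mul GA₁₂₃₄ _ (q := 1 / 2) (by norm_num)
      (by rw [Fintype.card_prod]; push_cast; exact h1234) h5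
    rw [show (Fintype.card (RunCoinsP n p β k T L m kk t) : ℝ) =
        Fintype.card ((((AdvCoins L m × VNCoins (SBlk n k p β) T p) × SGCoinsP p k kk) × DCCoinsP n p β k t)) *
          Fintype.card (Fin (jB p β)) by rw [← Nat.cast_mul, ← Fintype.card_prod]]
    refine le_trans (le_of_eq (by ring)) (h12345.trans ?_)
    exact_mod_cast card_le_card (monotone_filter_right _ fun ω _ h => And.right h)
  · rw [not_le] at hq
    refine le_trans ?_ (Nat.cast_nonneg _)
    have hpos : (0 : ℝ) ≤ 1 / (10 * L) * (μ / 2) * ρ * (3 * ρ / 16) * (1 / 2) *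
        Fintype.card (RunCoinsP n p β k T L m kk t) := by positivity
    nlinarith

end Run

end Literature.Computability.Learning
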